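import Literature.NumberTheory.LFunctions.MoebiusCharacterSumBoundProofs
import Mathlib.NumberTheory.DirichletCharacter.Orthogonality
import HarnessLib

/-!
# The Siegel–Walfisz theorem for the Möbius function (Montgomery–Vaughan §11.3 Exercise 13(f)), proved

Topic `Literature/NumberTheory/LFunctions`. Everything in this file is PROVED (theorems only); it
discharges the named fact `Literature.NumberTheory.LFunctions.SiegelWalfiszMoebius`
(`SiegelWalfiszMoebius.lean`; MV §11.3 Exercise 13(f), p. 384):

> there is an absolute `c > 0` such that for every `A > 0` there is `C` with
> `|∑_{n ≤ x, n ≡ a (q)} μ(n)| ≤ C x exp(−c√log x)` for all `x ≥ 2`, `1 ≤ q ≤ (log x)^A` and EVERY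
> residue `a (mod q)` (coprime to `q` or not).

## The argument (MV Exercise 13, from Exercise 8)

Let `a₀` represent `a`, `d = (a₀, q)`, `q = dr`, `a₀ = db`, so `(b, r) = 1`. A term `n ≡ a₀ (q)`
is `n = dm` with `m ≡ b (r)`, and `μ(dm) = μ(d)μ(m)𝟙_{(m,d)=1}`; on the class `m ≡ b (r)` the
conditions `(m, d) = 1` and `(m, q) = 1` agree (Exercise 13 (a)–(c) in this form:
`MoebiusProgression.sum_moebius_residue_eq`):

  `M(x; q, a) = μ(d) ∑_{m ≤ x/d, m ≡ b (r), (m, q) = 1} μ(m)`.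

By orthogonality of the characters mod `r`, LIFTED to modulus `q` (so that they detect
`(m, q) = 1`; Exercise 9 adapted, `MoebiusProgression.totient_mul_sum_eq_sum_characters`),
`φ(r) ∑_{m ≤ y, m ≡ b (r), (m,q)=1} μ(m) = ∑_{χ mod r} χ̄(b) M(y, χ↑)`, and each `M(y, χ↑)` is
`≪_{2A} y exp(−c₁√log y)` by Exercise 8 (`MoebiusCharacterSumBound_holds`,
`MoebiusCharacterSumBoundProofs.lean`) applied at `y = x/d` with modulus `q ≤ (log y)^{2A}`:
indeed `d ≤ q ≤ (log x)^A` gives `log y ≥ (log x)/2 ≥ 2` once `log x ≥ max(16A², 4)`, smaller `x`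
being trivial (`|M(x; q, a)| ≤ x`). This yields Exercise 13(f) with `c = c₁/2`
(`SiegelWalfiszMoebius.of_characterSumBound`, `SiegelWalfiszMoebius_holds`).

## References

* H. L. Montgomery, R. C. Vaughan, *Multiplicative Number Theory I. Classical Theory*, CUP 2007,
  §11.3, Exercises 8, 9 and 13 (pp. 383–384) (`MontgomeryVaughan2007`).
-/

noncomputable section

open Complex Filter Topology Metric Set Finset
open scoped ArithmeticFunction.Moebius

namespace Literature.NumberTheory.LFunctions

namespace MoebiusProgression

/-! ## Reduction of `M(x; q, a)` to coprime progressions (MV §11.3 Exercise 13 (a)–(c)) -/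

/-- `μ(dm) = μ(d)μ(m)` if `(m, d) = 1`, and `μ(dm) = 0` otherwise (`dm` is then not squarefree).
[folklore] -/
theorem moebius_mul_eq (d m : ℕ) :
    (μ (d * m) : ℝ) = if m.Coprime d then (μ d : ℝ) * μ m else 0 := by
  split_ifs with h
  · have := ArithmeticFunction.isMultiplicative_moebius.map_mul_of_coprime h.symm
    rw [this]; push_cast; ring
  · have hns : ¬ Squarefree (d * m) := fun hs ↦ h (Nat.squarefree_mul_iff.1 hs).1.symm
    rw [ArithmeticFunction.moebius_eq_zero_of_not_squarefree hns]; simp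

/-- **Reindexing a progression by its gcd**: if `q = dr`, `a₀ = db`, then `n ↦ n/d` is a
bijection from `{1 ≤ n ≤ N : n ≡ a₀ (mod q)}` onto `{1 ≤ m ≤ N/d : m ≡ b (mod r)}` with inverse
`m ↦ dm`. [cite: MontgomeryVaughan2007, §11.3 Exercise 13] -/
theorem sum_filter_residue_eq {q d r b a₀ : ℕ} [NeZero q] (hd : 0 < d) (hq : q = d * r)
    (ha₀ : a₀ = d * b) {a : ZMod q} (ha : (a₀ : ZMod q) = a) (f : ℕ → ℝ) (N : ℕ) :
    ∑ n ∈ (Finset.Icc 1 N).filter (fun n : ℕ ↦ (n : ZMod q) = a), f n =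
      ∑ m ∈ (Finset.Icc 1 (N / d)).filter (fun m : ℕ ↦ m ≡ b [MOD r]), f (d * m) := by
  have hmem : ∀ n : ℕ, (n : ZMod q) = a ↔ n ≡ a₀ [MOD q] := by
    intro n; rw [← ha, ZMod.natCast_eq_natCast_iff]
  have hdq : d ∣ q := ⟨r, hq⟩
  have hda : d ∣ a₀ := ⟨b, ha₀⟩
  symm
  refine Finset.sum_nbij' (fun m ↦ d * m) (fun n ↦ n / d) ?_ ?_ ?_ ?_ (fun _ _ ↦ rfl)
  · intro m hm
    rw [Finset.mem_filter, Finset.mem_Icc] at hm ⊢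
    obtain ⟨⟨hm1, hmN⟩, hmb⟩ := hm
    refine ⟨⟨Nat.mul_pos hd hm1, ?_⟩, ?_⟩
    · exact (Nat.mul_le_mul_left d hmN).trans (Nat.mul_div_le N d)
    · rw [hmem, ha₀, hq]
      exact Nat.ModEq.mul_left' d hmb
  · intro n hn
    rw [Finset.mem_filter, Finset.mem_Icc] at hn ⊢
    obtain ⟨⟨hn1, hnN⟩, hna⟩ := hn
    rw [hmem] at hna
    have hdn : d ∣ n := (hna.dvd_iff hdq).2 hda
    obtain ⟨m, rfl⟩ := hdn
    rw [Nat.mul_div_cancel_left m hd]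
    refine ⟨⟨?_, Nat.div_le_div_right hnN |>.trans' (by rw [Nat.mul_div_cancel_left m hd])⟩, ?_⟩
    · rcases Nat.eq_zero_or_pos m with h0 | h0
      · subst h0; simp at hn1
      · exact h0
    · rw [ha₀, hq] at hna
      exact Nat.ModEq.mul_left_cancel' hd.ne' hna
  · intro m _
    exact Nat.mul_div_cancel_left m hd
  · intro n hn
    rw [Finset.mem_filter] at hn
    have hna := (hmem n).1 hn.2
    have hdn : d ∣ n := (hna.dvd_iff hdq).2 hda
    exact Nat.mul_div_cancel' hdn

/-- For `m ≡ b (mod r)` with `(b, r) = 1` and `q = dr`: `(m, d) = 1 ↔ (m, q) = 1`. [folklore] -/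
theorem coprime_iff_of_modEq {q d r b m : ℕ} (hq : q = d * r) (hbr : Nat.Coprime b r)
    (hm : m ≡ b [MOD r]) : m.Coprime d ↔ m.Coprime q := by
  constructor
  · intro h
    rw [hq]
    refine Nat.Coprime.mul_right h ?_
    rw [Nat.Coprime, hm.gcd_eq]
    exact hbr
  · intro h
    exact h.coprime_dvd_right ⟨r, hq⟩

/-- **MV §11.3 Exercise 13 (a)–(c), in the form used here**: with `a₀` a representative of `a`,
`d = (a₀, q)`, `q = dr`, `a₀ = db` (so `(b, r) = 1`):
`∑_{n ≤ N, n ≡ a (q)} μ(n) = μ(d) ∑_{m ≤ N/d, m ≡ b (r), (m, q) = 1} μ(m)`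
(`μ(dm) = μ(d)μ(m)𝟙_{(m,d)=1}`, and `(m, d) = 1 ⟺ (m, q) = 1` on the class `m ≡ b (r)`).
[cite: MontgomeryVaughan2007, §11.3 Exercise 13] -/
theorem sum_moebius_residue_eq {q d r b a₀ : ℕ} [NeZero q] (hd : 0 < d) (hq : q = d * r)
    (ha₀ : a₀ = d * b) (hbr : Nat.Coprime b r) {a : ZMod q} (ha : (a₀ : ZMod q) = a) (N : ℕ) :
    ∑ n ∈ (Finset.Icc 1 N).filter (fun n : ℕ ↦ (n : ZMod q) = a), (μ n : ℝ) =
      (μ d : ℝ) * ∑ m ∈ (Finset.Icc 1 (N / d)).filter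
        (fun m : ℕ ↦ m ≡ b [MOD r] ∧ Nat.Coprime m q), (μ m : ℝ) := by
  rw [sum_filter_residue_eq hd hq ha₀ ha (fun n ↦ (μ n : ℝ)) N]
  simp only [moebius_mul_eq]
  rw [← Finset.sum_filter, Finset.filter_filter, Finset.mul_sum]
  refine Finset.sum_congr ?_ (fun _ _ ↦ rfl)
  ext m
  simp only [Finset.mem_filter]
  constructor
  · rintro ⟨hm, hb, hc⟩
    exact ⟨hm, hb, (coprime_iff_of_modEq hq hbr hb).1 hc⟩
  · rintro ⟨hm, hb, hc⟩
    exact ⟨hm, hb, (coprime_iff_of_modEq hq hbr hb).2 hc⟩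

/-! ## Detecting `m ≡ b (r), (m, q) = 1` with the characters mod `r` lifted to level `q` -/

/-- **Orthogonality with lifted characters** (MV §11.3 Exercise 9, adapted): for `r ∣ q`,
`(b, r) = 1`:
`φ(r) ∑_{m ≤ M, m ≡ b (r), (m,q)=1} μ(m) = ∑_{χ mod r} χ̄(b) ∑_{m ≤ M} μ(m) χ↑(m)`, where
`χ↑ = changeLevel χ` is `χ` regarded modulo `q` (it vanishes unless `(m, q) = 1`).
[cite: MontgomeryVaughan2007, §11.3 Exercise 9] -/
theorem totient_mul_sum_eq_sum_characters {q r b : ℕ} [NeZero q] [NeZero r] (hrq : r ∣ q)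
    (hbr : Nat.Coprime b r) (M : ℕ) :
    ((r.totient : ℂ) * ∑ m ∈ (Finset.Icc 1 M).filter
        (fun m : ℕ ↦ m ≡ b [MOD r] ∧ Nat.Coprime m q), (μ m : ℂ)) =
      ∑ χ : DirichletCharacter ℂ r, χ (b : ZMod r)⁻¹ *
        ∑ m ∈ Finset.Icc 1 M, (μ m : ℂ) * DirichletCharacter.changeLevel hrq χ (m : ZMod q) := by
  have hbu : IsUnit ((b : ℕ) : ZMod r) := (ZMod.isUnit_iff_coprime b r).2 hbr
  -- swap the sums
  have hswap : ∑ χ : DirichletCharacter ℂ r, χ (b : ZMod r)⁻¹ *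
      ∑ m ∈ Finset.Icc 1 M, (μ m : ℂ) * DirichletCharacter.changeLevel hrq χ (m : ZMod q) =
      ∑ m ∈ Finset.Icc 1 M, (μ m : ℂ) *
        ∑ χ : DirichletCharacter ℂ r, χ (b : ZMod r)⁻¹ * DirichletCharacter.changeLevel hrq χ (m : ZMod q) := by
    simp_rw [Finset.mul_sum]
    rw [Finset.sum_comm]
    refine Finset.sum_congr rfl fun m _ ↦ Finset.sum_congr rfl fun χ _ ↦ by ring
  rw [hswap, Finset.mul_sum, Finset.sum_filter]
  refine Finset.sum_congr rfl fun m _ ↦ ?_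
  by_cases hcop : Nat.Coprime m q
  · -- `χ↑(m) = χ(m)`, then orthogonality mod `r`
    have hlift : ∀ χ : DirichletCharacter ℂ r,
        DirichletCharacter.changeLevel hrq χ (m : ZMod q) = χ (m : ZMod r) := by
      intro χ
      have h := DirichletCharacter.changeLevel_eq_cast_of_dvd' χ hrq (a := (m : ℤ))
        (Nat.isCoprime_iff_coprime.2 hcop)
      simpa using h
    simp_rw [hlift]
    rw [DirichletCharacter.sum_char_inv_mul_char_eq ℂ hbu]
    have hiff : ((b : ZMod r) = (m : ZMod r)) ↔ m ≡ b [MOD r] := by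
      rw [ZMod.natCast_eq_natCast_iff]; exact ⟨Nat.ModEq.symm, Nat.ModEq.symm⟩
    by_cases hmb : m ≡ b [MOD r]
    · rw [if_pos (hiff.2 hmb), if_pos ⟨hmb, hcop⟩]; ring
    · rw [if_neg (fun h ↦ hmb (hiff.1 h)), if_neg (fun h ↦ hmb h.1)]; ring
  · -- `m` is not a unit mod `q`: every lifted character vanishes
    have hnu : ¬ IsUnit ((m : ℕ) : ZMod q) := fun h ↦ hcop ((ZMod.isUnit_iff_coprime m q).1 h)
    have h0 : ∀ χ : DirichletCharacter ℂ r, DirichletCharacter.changeLevel hrq χ (m : ZMod q) = 0 :=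
      fun χ ↦ MulChar.map_nonunit _ hnu
    simp_rw [h0, mul_zero, Finset.sum_const_zero, mul_zero]
    rw [if_neg (fun h ↦ hcop h.2)]

/-- **The coprime-progression sum in terms of twisted sums**: for `r ∣ q`, `(b, r) = 1`, if every
`‖∑_{m ≤ M} μ(m)χ↑(m)‖ ≤ B` (`χ` mod `r`), then `|∑_{m ≤ M, m ≡ b (r), (m,q)=1} μ(m)| ≤ B`
(there are `φ(r)` characters mod `r`). [cite: MontgomeryVaughan2007, §11.3 Exercises 9 and 13] -/
theorem abs_sum_coprime_progression_le {q r b : ℕ} [NeZero q] [NeZero r] (hrq : r ∣ q)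
    (hbr : Nat.Coprime b r) (M : ℕ) {B : ℝ}
    (hB : ∀ χ : DirichletCharacter ℂ r,
      ‖∑ m ∈ Finset.Icc 1 M, (μ m : ℂ) * DirichletCharacter.changeLevel hrq χ (m : ZMod q)‖ ≤ B) :
    |∑ m ∈ (Finset.Icc 1 M).filter (fun m : ℕ ↦ m ≡ b [MOD r] ∧ Nat.Coprime m q), (μ m : ℝ)| ≤ B := by
  have hφ : 0 < (r.totient : ℝ) := by exact_mod_cast Nat.totient_pos.2 (NeZero.pos r)
  have hcard : (Finset.univ : Finset (DirichletCharacter ℂ r)).card = r.totient := by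
    rw [Finset.card_univ, ← Nat.card_eq_fintype_card]
    exact DirichletCharacter.card_eq_totient_of_hasEnoughRootsOfUnity ℂ r
  have h := totient_mul_sum_eq_sum_characters hrq hbr M
  set T : ℝ := ∑ m ∈ (Finset.Icc 1 M).filter (fun m : ℕ ↦ m ≡ b [MOD r] ∧ Nat.Coprime m q), (μ m : ℝ)
    with hT
  have hTc : (∑ m ∈ (Finset.Icc 1 M).filter (fun m : ℕ ↦ m ≡ b [MOD r] ∧ Nat.Coprime m q),
      (μ m : ℂ)) = (T : ℂ) := by rw [hT]; push_cast; rfl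
  rw [hTc] at h
  have hnorm : (r.totient : ℝ) * |T| ≤ (r.totient : ℝ) * B := by
    calc (r.totient : ℝ) * |T| = ‖((r.totient : ℂ)) * (T : ℂ)‖ := by
          rw [norm_mul, Complex.norm_natCast, Complex.norm_real, Real.norm_eq_abs]
      _ = ‖∑ χ : DirichletCharacter ℂ r, χ (b : ZMod r)⁻¹ *
            ∑ m ∈ Finset.Icc 1 M, (μ m : ℂ) * DirichletCharacter.changeLevel hrq χ (m : ZMod q)‖ := by
          rw [h]
      _ ≤ ∑ χ : DirichletCharacter ℂ r, ‖χ (b : ZMod r)⁻¹ *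
            ∑ m ∈ Finset.Icc 1 M, (μ m : ℂ) * DirichletCharacter.changeLevel hrq χ (m : ZMod q)‖ :=
          norm_sum_le _ _
      _ ≤ ∑ _χ : DirichletCharacter ℂ r, B := by
          refine Finset.sum_le_sum fun χ _ ↦ ?_
          rw [norm_mul]
          calc ‖χ (b : ZMod r)⁻¹‖ * ‖∑ m ∈ Finset.Icc 1 M, (μ m : ℂ) *
                DirichletCharacter.changeLevel hrq χ (m : ZMod q)‖ ≤ 1 * B :=
                mul_le_mul (DirichletCharacter.norm_le_one χ _) (hB χ) (norm_nonneg _) zero_le_one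
            _ = B := one_mul B
      _ = (r.totient : ℝ) * B := by rw [Finset.sum_const, hcard, nsmul_eq_mul]
  exact le_of_mul_le_mul_left hnorm hφ

end MoebiusProgression

/-! ## MV §11.3 Exercise 13(f): the Siegel–Walfisz theorem for `μ`, all residues -/

open MoebiusProgression in
set_option maxHeartbeats 1600000 in
/-- **From Exercise 8 to Exercise 13(f)**: `MoebiusCharacterSumBound → SiegelWalfiszMoebius`.
For `q ≤ (log x)^A` and ANY residue `a` mod `q`: with `d = (a, q)`, `q = dr`, `a = db`,
`M(x; q, a) = μ(d) ∑_{m ≤ x/d, m ≡ b (r), (m,q)=1} μ(m)` (`sum_moebius_residue_eq`), and the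
inner sum is `φ(r)^{-1} ∑_{χ mod r} χ̄(b) M(x/d, χ↑)` with `χ↑` mod `q`
(`abs_sum_coprime_progression_le`), each `M(x/d, χ↑) ≪_{2A} (x/d) exp(−c₁√log(x/d))` by
Exercise 8 at `y = x/d ≥ x/(log x)^A`, where `log y ≥ (log x)/2` as soon as `log x ≥ 16A²`
(then `q ≤ (log y)^{2A}`); smaller `x` are trivial. Hence `M(x; q, a) ≪_A x exp(−(c₁/2)√log x)`.
[cite: MontgomeryVaughan2007, §11.3 Exercise 13(f) p. 384] -/
theorem SiegelWalfiszMoebius.of_characterSumBound (h : MoebiusCharacterSumBound) :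
    SiegelWalfiszMoebius := by
  obtain ⟨c₁, hc₁, hA⟩ := h
  refine ⟨c₁ / 2, by positivity, fun A hApos ↦ ?_⟩
  obtain ⟨C', hC'⟩ := hA (2 * A) (by positivity)
  -- `C' ≥ 0` may fail; use `max C' 0`
  set C₁ : ℝ := max C' 0 with hC₁
  have hC₁0 : 0 ≤ C₁ := le_max_right _ _
  set U : ℝ := max (16 * A ^ 2) 4 with hU
  have hU4 : 4 ≤ U := le_max_right _ _
  have hUA : 16 * A ^ 2 ≤ U := le_max_left _ _
  set Csmall : ℝ := Real.exp (c₁ / 2 * Real.sqrt U) with hCsmall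
  refine ⟨C₁ + Csmall, fun x hx q hq hqx a ↦ ?_⟩
  haveI : NeZero q := ⟨by omega⟩
  have hx0 : 0 < x := by linarith
  set L : ℝ := Real.log x with hL
  have hL0 : 0 < L := Real.log_pos (by linarith)
  set E : ℝ := Real.exp (-(c₁ / 2) * Real.sqrt L) with hEdef
  have hE0 : 0 < E := Real.exp_pos _
  set N : ℕ := ⌊x⌋₊ with hN
  -- the decomposition `a₀ = d b`, `q = d r`
  set a₀ : ℕ := a.val with ha₀def
  have ha : ((a₀ : ℕ) : ZMod q) = a := ZMod.natCast_zmod_val a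
  set d : ℕ := Nat.gcd a₀ q with hddef
  have hd0 : 0 < d := Nat.gcd_pos_of_pos_right _ (by omega)
  obtain ⟨r, hqr⟩ : d ∣ q := Nat.gcd_dvd_right a₀ q
  obtain ⟨b, hab⟩ : d ∣ a₀ := Nat.gcd_dvd_left a₀ q
  have hr0 : 0 < r := by
    rcases Nat.eq_zero_or_pos r with h0 | h0
    · exfalso; rw [h0, mul_zero] at hqr; omega
    · exact h0
  haveI : NeZero r := ⟨hr0.ne'⟩
  have hbr : Nat.Coprime b r := by
    have h1 : Nat.gcd a₀ q = d * Nat.gcd b r := by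
      conv_lhs => rw [hab, hqr]
      exact Nat.gcd_mul_left d b r
    rw [← hddef] at h1
    have : d * Nat.gcd b r = d * 1 := by rw [← h1, mul_one]
    exact Nat.eq_of_mul_eq_mul_left hd0 this
  have hrq : r ∣ q := ⟨d, by rw [hqr, mul_comm]⟩
  have hdq : (d : ℝ) ≤ q := by exact_mod_cast Nat.le_of_dvd (by omega) ⟨r, hqr⟩
  have hd1 : (1 : ℝ) ≤ d := by exact_mod_cast hd0
  -- the identity
  have hident := sum_moebius_residue_eq hd0 hqr hab hbr ha N
  rw [hident]
  set T : ℝ := ∑ m ∈ (Finset.Icc 1 (N / d)).filter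
      (fun m : ℕ ↦ m ≡ b [MOD r] ∧ Nat.Coprime m q), (μ m : ℝ) with hT
  have hμd : |(μ d : ℝ)| ≤ 1 := by exact_mod_cast ArithmeticFunction.abs_moebius_le_one
  have hTtriv : |T| ≤ x := by
    calc |T| ≤ ∑ m ∈ (Finset.Icc 1 (N / d)).filter
          (fun m : ℕ ↦ m ≡ b [MOD r] ∧ Nat.Coprime m q), |(μ m : ℝ)| := Finset.abs_sum_le_sum_abs _ _
      _ ≤ ∑ m ∈ (Finset.Icc 1 (N / d)).filter
          (fun m : ℕ ↦ m ≡ b [MOD r] ∧ Nat.Coprime m q), (1 : ℝ) :=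
          Finset.sum_le_sum fun m _ ↦ by exact_mod_cast ArithmeticFunction.abs_moebius_le_one
      _ = ((Finset.Icc 1 (N / d)).filter (fun m : ℕ ↦ m ≡ b [MOD r] ∧ Nat.Coprime m q)).card := by
          rw [Finset.sum_const, nsmul_eq_mul, mul_one]
      _ ≤ (Finset.Icc 1 (N / d)).card := by exact_mod_cast Finset.card_filter_le _ _
      _ = (N / d : ℕ) := by rw [Nat.card_Icc]; simp
      _ ≤ N := by exact_mod_cast Nat.div_le_self N d
      _ ≤ x := Nat.floor_le hx0.le
  have habsprod : |(μ d : ℝ) * T| ≤ |T| := by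
    rw [abs_mul]; exact mul_le_of_le_one_left (abs_nonneg _) hμd
  rcases lt_or_ge L U with hLU | hLU
  · -- small `x`
    have h1 : 1 ≤ Csmall * E := by
      rw [hCsmall, hEdef, ← Real.exp_add]
      refine Real.one_le_exp ?_
      have : Real.sqrt L ≤ Real.sqrt U := Real.sqrt_le_sqrt hLU.le
      nlinarith
    calc |(μ d : ℝ) * T| ≤ |T| := habsprod
      _ ≤ x := hTtriv
      _ ≤ x * (Csmall * E) := le_mul_of_one_le_right hx0.le h1
      _ ≤ (C₁ + Csmall) * x * E := by
          have : 0 ≤ C₁ * x * E := by positivity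
          nlinarith
  · -- large `x`: apply Exercise 8 at `y = x/d` with exponent `2A`
    have hL4 : 4 ≤ L := hU4.trans hLU
    have hq1 : (1 : ℝ) ≤ q := by exact_mod_cast hq
    have hq0 : (0 : ℝ) < q := by linarith
    -- `log d ≤ log q ≤ A log L ≤ 2A√L ≤ L/2`
    have hlogd : Real.log d ≤ L / 2 := by
      have h1 : Real.log d ≤ Real.log q := Real.log_le_log (by linarith) hdq
      have h2 : Real.log q ≤ A * Real.log L := by
        calc Real.log q ≤ Real.log (L ^ A) := Real.log_le_log hq0 hqx
          _ = A * Real.log L := Real.log_rpow hL0 A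
      have h3 : A * Real.log L ≤ 2 * A * Real.sqrt L := by
        -- `log L ≤ 2√L` (as in the tree's `SelbergSymmetry.log_le_two_mul_sqrt`)
        have hlog : Real.log L ≤ 2 * Real.sqrt L := by
          have hs : 0 < Real.sqrt L := Real.sqrt_pos.2 hL0
          calc Real.log L = Real.log (Real.sqrt L ^ 2) := by rw [Real.sq_sqrt hL0.le]
            _ = 2 * Real.log (Real.sqrt L) := by rw [Real.log_pow]; norm_num
            _ ≤ 2 * (Real.sqrt L - 1) := by linarith [Real.log_le_sub_one_of_pos hs]
            _ ≤ 2 * Real.sqrt L := by linarith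
        nlinarith
      have h4 : 2 * A * Real.sqrt L ≤ L / 2 := by
        have hsA : 4 * A ≤ Real.sqrt L := by
          have : Real.sqrt (16 * A ^ 2) ≤ Real.sqrt L := Real.sqrt_le_sqrt (hUA.trans hLU)
          rwa [show (16 : ℝ) * A ^ 2 = (4 * A) ^ 2 by ring, Real.sqrt_sq (by positivity)] at this
        have hs := Real.sq_sqrt hL0.le
        nlinarith [Real.sqrt_nonneg L]
      linarith
    set y : ℝ := x / d with hy
    have hd0' : (0 : ℝ) < d := by linarith
    have hy0 : 0 < y := div_pos hx0 hd0'
    have hlogy : Real.log y = L - Real.log d := by rw [hy, Real.log_div hx0.ne' hd0'.ne']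
    have hlogy2 : L / 2 ≤ Real.log y := by rw [hlogy]; linarith
    have hlogy1 : 2 ≤ Real.log y := by linarith
    have hy2 : 2 ≤ y := by
      have h1 : Real.exp 2 ≤ Real.exp (Real.log y) := Real.exp_le_exp.2 hlogy1
      rw [Real.exp_log hy0] at h1
      have h2 : (2 : ℝ) ≤ Real.exp 2 := by linarith [Real.add_one_le_exp (2 : ℝ)]
      linarith
    have hyx : y ≤ x := div_le_self hx0.le hd1
    -- `q ≤ (log y)^{2A}`
    have hqy : (q : ℝ) ≤ Real.log y ^ (2 * A) := by
      have hly0 : 0 < Real.log y := by linarith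
      calc (q : ℝ) ≤ L ^ A := hqx
        _ ≤ (2 * Real.log y) ^ A := Real.rpow_le_rpow hL0.le (by linarith) hApos.le
        _ ≤ (Real.log y * Real.log y) ^ A := by
            refine Real.rpow_le_rpow (by positivity) ?_ hApos.le
            nlinarith
        _ = Real.log y ^ (2 * A) := by
            rw [← sq, ← Real.rpow_natCast, ← Real.rpow_mul hly0.le]; norm_num
    -- Exercise 8 for every character mod `r`, lifted to `q`, at `y`
    have hNd : N / d = ⌊y⌋₊ := by rw [hy, hN, Nat.floor_div_natCast]
    have hB : ∀ χ : DirichletCharacter ℂ r,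
        ‖∑ m ∈ Finset.Icc 1 (N / d), (μ m : ℂ) *
          DirichletCharacter.changeLevel hrq χ (m : ZMod q)‖ ≤ C₁ * y * Real.exp (-c₁ * Real.sqrt (Real.log y)) := by
      intro χ
      rw [hNd]
      refine (hC' y hy2 q hq hqy (DirichletCharacter.changeLevel hrq χ)).trans ?_
      refine mul_le_mul_of_nonneg_right (mul_le_mul_of_nonneg_right (le_max_left _ _) hy0.le) ?_
      exact (Real.exp_pos _).le
    have hTb := abs_sum_coprime_progression_le hrq hbr (N / d) hB
    -- `y e^{−c₁√log y} ≤ x E`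
    have hexp : Real.exp (-c₁ * Real.sqrt (Real.log y)) ≤ E := by
      rw [hEdef]
      refine Real.exp_le_exp.2 ?_
      have h1 : Real.sqrt L / 2 ≤ Real.sqrt (Real.log y) := by
        rw [Real.le_sqrt (by positivity) (by linarith)]
        have := Real.sq_sqrt hL0.le
        nlinarith
      nlinarith
    calc |(μ d : ℝ) * T| ≤ |T| := habsprod
      _ ≤ C₁ * y * Real.exp (-c₁ * Real.sqrt (Real.log y)) := hTb
      _ ≤ C₁ * x * E := by
          refine mul_le_mul (mul_le_mul_of_nonneg_left hyx hC₁0) hexp (Real.exp_pos _).le ?_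
          positivity
      _ ≤ (C₁ + Csmall) * x * E := by
          have : 0 ≤ Csmall * x * E := by positivity
          nlinarith

/-- **The Siegel–Walfisz theorem for the Möbius function (Montgomery–Vaughan §11.3
Exercise 13(f)), PROVED**: the named fact `Literature.NumberTheory.LFunctions.SiegelWalfiszMoebius`
holds — there is an absolute `c > 0` such that for every `A > 0` there is `C` with
`|∑_{n ≤ x, n ≡ a (q)} μ(n)| ≤ C x exp(−c√log x)` for all `x ≥ 2`, `1 ≤ q ≤ (log x)^A` and every
residue `a` mod `q`. Assembled from `MoebiusCharacterSumBound_holds` (Exercise 8) and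
`SiegelWalfiszMoebius.of_characterSumBound` (Exercise 13).
[cite: MontgomeryVaughan2007, §11.3 Exercise 13(f) p. 384] -/
theorem SiegelWalfiszMoebius_holds : SiegelWalfiszMoebius :=
  SiegelWalfiszMoebius.of_characterSumBound MoebiusCharacterSumBound_holds

end Literature.NumberTheory.LFunctions
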